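import Summits.HodgeConjecture.HodgeConjecture.Theorems.HLiu418AlbaneseH1ComparisonUnconditional
import Literature.NumberTheory.Automorphic.Liu2021.AppendixC.TowerMorphismSeesawDetection
import Literature.AlgebraicGeometry.Motives.VarietiesDimensionProofs
import HarnessLib

/-!
# [Liu 2021, Lem. 2.4 (1)] HYPOTHESIS-FREE for smooth projective curves, and the GS-7 spine with its Albanese
# comparisons DISCHARGED (`cmpT`/`cmpS := albaneseH1Cmp`, `hnat`, `hinjS`)

Cell `hodgecm-mathlib`, fan A, crux `hLiu418` (stmt-HodgeConjecture-24832), line `a3_liu418`, GS-7 clause (1)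
(KEY `gs7-clause1-lead`: the (7-main) lead's owed items «`hinjS` via the ★ `…_of_lemma24Proj` heads» and «`cmpT`/`hnat` by
★ `albaneseH1Cmp(_natural)`»).  THEOREMS ONLY — no `def`, no named fact, no instance, no `sorry`; Literature debt 0.

The GS-7 spine ★ `Sec42Data.BettiPinning.exists_scheme_class_detecting_le'` (`AppendixC/TowerMorphismSeesawDetection` §5)
quantifies, for every morphism of towers `M`, over ARBITRARY level comparisons `cmpT : H¹_{B,τ'}(A_K″, ℂ) → H¹_{B,τ'}(X_K″, ℂ)`,
`cmpS` (source level), a naturality square `hnat` at `(Sh(φ)_K″, Alb(Sh(φ)_K″))` and `hinjS : Injective cmpS`.  At the cell's face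
all four are fed by the Summits-side construction ★ `albaneseH1Cmp X a = ((α_X)_x)^*` (`CorCM/HypLiu418/AlbaneseH1ComparisonOfLemma24`,
[Liu2021] Lem. 2.4 (1) with Def. 2.3).  This file feeds them ONCE, generically:

* §1 — over A-p16's ★ `AlbanesePieces.complexBetti_map_albAt_bijective_of_finrank_le` (`Theorems/HLiu418AlbaneseH1ComparisonUnconditional`,
  p675997: Lemma 2.4 (1) for the chosen pieces from the PROVED projective edition ★ `albanese_bettiOne_pullback_bijective_of_isProjectiveOver`
  under the per-piece complex Albanese bound (R-ℂ) `b₁(Y_q) ≤ 2 dim J(Y_q)` — NO named fact): `AlbanesePieces.d_eq` — the pieces of an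
  `X` smooth of relative dimension `d` have dimension `d` (Krull dimension of a non-empty smooth scheme over a field, ★
  `Motives.topologicalKrullDim_eq_of_smoothOfRelativeDimension`, through the open-immersion leg ★ `Morphisms.isOpenImmersion_of_isColimit_cofan`),
  so for a CURVE `X` every pieces datum has curve pieces and (R-ℂ) is the THEOREM ★ `Motives.two_mul_dim_eq_finrank_bettiCohomology_holds`
  (`2 dim J(C) = b₁(C)`): `AlbanesePieces.complexBetti_map_albAt_bijective_of_curve`, and in the `albaneseH1Cmp` currency (★ `albaneseH1Cmp_eq`)
  **`albaneseH1Cmp_bijective_of_curve`: for `X / k` projective and smooth of relative dimension `1` (`k → ℂ`) and any Albanese datum `a`,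
  `albaneseH1Cmp X a : H¹_{B}(Alb_X ⊗ ℂ, ℂ) → H¹_{B}(X ⊗ ℂ, ℂ)` is bijective** — no hypothesis.  Also: `complexBetti_map_albAt_apply_eq` /
  `albaneseH1Cmp_eq_complexBetti_map_albAt` — `((α_X)_x)^*` does not depend on the pieces datum, so `albaneseH1Cmp X a` is `(D.albAt a)^*` for
  EVERY `D` (a consumer reads it on its OWN cofan: `bijective/injective_albaneseH1Cmp_of_cofan_ballDatum` for ball-quotient surface pieces,
  A-p16's (M3); `injective_albaneseH1Cmp_of_cofan_curve`, (M2)).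
* §2 — the feeds in `AppendixC` currency (`algebraAlong E τ'`): `towerHom_albaneseH1Cmp_bettiPullAlong_albMap` (= `hnat`, from ★
  `albaneseH1Cmp_natural` fed with ★ `Nabla.map_incl`, ★ `TowerHom.α_albMap`, ★ `CompactifiedSystem.smooth_X/projective_X` —
  verbatim the feeding of ★ `TowerHom.albCmp_bettiPullAlong_albMap`, without the family `cA`);
  `sec42Data_injective_albaneseH1Cmp_of_n_eq_two` (= `hinjS` for every tower of CURVES, `P5ₛ.n = 2`, e.g. the GS source);
  and the spine WITH HECKE RE-ENTRY (★ §6 `exists_scheme_class_detecting_hecke'`, A-p18 p676404) with `cmpT`/`cmpS := albaneseH1Cmp` and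
  `hnat` discharged, `bettiPinning_exists_scheme_class_detecting_hecke_albaneseH1Cmp` (the head the (7-main)/GS-8 closer `exact`s — its
  consumer's currency word 23:03:38Z): the ∀-clause reads `∀ M, hIₛ → Injective (albaneseH1Cmp X⋆_{φ⁻¹Λ} A⋆) →
  (Sh(φ)_Λ ×_{τ'} ℂ)^* (albaneseH1Cmp X_Λ A_Λ (Alb(T_g)^* y″)) ≠ 0 → ((1 ⊗ M.toEtaleTowerHom.etPull)).comp f ≠ 0`, and
  `…_of_n_eq_two` with the injectivity fed for curve sources.

HC_CM is proved only modulo the 7 printed citations until rung 0 closes; this file discharges none of them by itself.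

## References
* [Liu2021] Y. Liu, *Fourier–Jacobi cycles and arithmetic relative trace formula*, Camb. J. Math. 9 (2021) = arXiv:2102.11518
  (`FJcycle.tex`): Def. 2.3 (l. 1202–1208), Lem. 2.4 (1) with proof (l. 1210–1228), §4.2 (l. 2064–2081), Thm. 4.15 proof
  (l. 2199–2213) with fn. 9.
* [Milne1986JacobianVarieties] J. S. Milne, *Jacobian Varieties*, in Cornell–Silverman, *Arithmetic Geometry* (1986), §2 Prop. 2.1,
  §7 Thm. 7.1 (`2 dim J(C) = b₁(C)`).
* [GortzWedhorn2020] U. Görtz, T. Wedhorn, *Algebraic Geometry I* (2nd ed. 2020), Lemma 6.26 with Lemma 5.7 (4) (dimension of smooth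
  schemes), §(3.5) Example 3.11 (coproducts).
* [HatcherAT2002] A. Hatcher, *Algebraic Topology* (2002), §3.1 Thm. 3.2 (universal coefficients).
-/

set_option autoImplicit false

noncomputable section

open CategoryTheory CategoryTheory.Limits AlgebraicGeometry NumberField Function
open Literature.NumberTheory.Automorphic.Liu2021 Literature.NumberTheory.Automorphic.Liu2021.AppendixC

namespace Summit.HodgeConjecture.CorCM.D2Bridge

/-! ## §1 Lemma 2.4 (1) for the chosen pieces from the PROJECTIVE edition; the curve case hypothesis-free -/

section PiecesAndCurves

open Literature.AlgebraicGeometry.Motives Literature.AlgebraicGeometry.HodgeTheory Literature.AlgebraicGeometry.ShimuraVarieties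
open Literature.AlgebraicTopology.SingularHomology
open AbelianVariety (bcSpec bcFunctor)

namespace AlbanesePieces

variable {k : Type} [Field k] [Algebra k ℂ] {X : SchemeOver k} (D : AlbanesePieces X) (a : Albanese X)

/-- **`(α_X)_x^*` on cohomology does NOT depend on the pieces datum** (pieces AND base points): for two pieces data `D`, `G` of the
same `X`, `((α_X)_x^D)^* = ((α_X)_{x'}^G)^*` on `Hⁱ((Alb_X ⊗ ℂ)(ℂ); ℂ)` — ★ `complexBetti_map_albAt_natural` at the α-compatible pair
`(𝟙 X, 𝟙 ∇X, 𝟙 Alb_X)`: two base-point choices differ piecewise by a translation, invisible on cohomology («independent of the choice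
of `x` since translation acts trivially», l. 1226–1228). [cite: Liu2021, proof of Lemma 2.4 (1) (FJcycle.tex l. 1220–1228)] -/
theorem complexBetti_map_albAt_apply_eq (G : AlbanesePieces X) (i : ℕ) (y : complexBetti (a.Alb.baseChange ℂ).X i) :
    (complexBetti.map (D.albAt a) i).hom y = (complexBetti.map (G.albAt a) i).hom y := by
  have h := D.complexBetti_map_albAt_natural G a a (𝟙 X) (𝟙 _) (𝟙 a.Alb) (by simp)
    (by change a.α ≫ 𝟙 _ = 𝟙 _ ≫ a.α; rw [Category.comp_id, Category.id_comp]) i y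
  have e1 : (complexBetti.map (AbelianVariety.Hom.baseChange ℂ (𝟙 a.Alb)).hom.hom.hom i).hom y = y := by
    rw [AbelianVariety.Hom.baseChange_id]
    change (complexBetti.map (𝟙 (a.Alb.baseChange ℂ).X) i).hom y = y
    rw [complexBetti.map_id]
    rfl
  have e2 : (complexBetti.map ((bcFunctor k ℂ).map (𝟙 X)) i).hom ((complexBetti.map (G.albAt a) i).hom y) =
      (complexBetti.map (G.albAt a) i).hom y := by
    rw [CategoryTheory.Functor.map_id, complexBetti.map_id]
    rfl
  rw [e1, e2] at h
  exact h

/-- The same as an identity of `ℂ`-linear maps `Hⁱ((Alb_X ⊗ ℂ)(ℂ); ℂ) → Hⁱ((X ⊗ ℂ)(ℂ); ℂ)`.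
[cite: Liu2021, proof of Lemma 2.4 (1) (FJcycle.tex l. 1220–1228)] -/
theorem complexBetti_map_albAt_hom_eq (G : AlbanesePieces X) (i : ℕ) :
    (complexBetti.map (D.albAt a) i).hom = (complexBetti.map (G.albAt a) i).hom :=
  LinearMap.ext fun y ↦ D.complexBetti_map_albAt_apply_eq a G i y

/-- **The pieces of an `X` smooth of relative dimension `d` have dimension `d`**: `D.d = d` as soon as a piece `q` exists.  The piece
`Y_q` is smooth projective of dimension `D.d`, so its Krull dimension is `D.d`; its leg `Y_q ⟶ X ⊗_k ℂ` is an open immersion (legs of a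
colimit cofan, ★ `Morphisms.isOpenImmersion_of_isColimit_cofan`) into a scheme smooth of relative dimension `d` over `ℂ`, so `Y_q` is
smooth of relative dimension `0 + d` over `ℂ` and its Krull dimension is `d` (★ `Motives.topologicalKrullDim_eq_of_smoothOfRelativeDimension`,
a non-empty smooth scheme over a field). [cite: GortzWedhorn2020, Lemma 6.26 with Lemma 5.7 (4); §(3.5) Example 3.11] [cite: Liu2021, proof of Lemma 2.4 (1) (FJcycle.tex l. 1220–1222)] -/
theorem d_eq {d : ℕ} [SmoothOfRelativeDimension d X.hom] (q : D.Ξ) : D.d = d := by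
  -- the piece: smooth projective geometrically irreducible of dimension `D.d`
  haveI : SmoothOfRelativeDimension D.d (D.Y q).hom := (D.smoothProjective q).smoothOfRelativeDimension
  haveI : GeometricallyIrreducible (D.Y q).hom := (D.smoothProjective q).geometricallyIrreducible
  haveI : IrreducibleSpace (D.Y q).left := GeometricallyIrreducible.irreducibleSpace_of_subsingleton (D.Y q).hom
  have h1 : topologicalKrullDim (D.Y q).left = (D.d : WithBot ℕ∞) :=
    topologicalKrullDim_eq_of_smoothOfRelativeDimension (D.Y q).hom D.d
  -- the leg: an open immersion into `X ⊗_k ℂ`, smooth of relative dimension `d` over `ℂ`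
  obtain ⟨hc⟩ := Literature.AlgebraicGeometry.Morphisms.isColimit_cofan_left D.isColimit
  haveI : IsOpenImmersion (D.inj q).left := Literature.AlgebraicGeometry.Morphisms.isOpenImmersion_of_isColimit_cofan hc q
  have := smoothOfRelativeDimension_isStableUnderBaseChange d
  haveI : SmoothOfRelativeDimension d ((bcFunctor k ℂ).obj X).hom :=
    MorphismProperty.pullback_snd (P := @SmoothOfRelativeDimension d) _ _ ‹_›
  have hs : SmoothOfRelativeDimension (0 + d) ((D.inj q).left ≫ ((bcFunctor k ℂ).obj X).hom) := inferInstance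
  rw [Over.w, Nat.zero_add] at hs
  have h2 : topologicalKrullDim (D.Y q).left = (d : WithBot ℕ∞) :=
    @topologicalKrullDim_eq_of_smoothOfRelativeDimension _ _ _ (D.Y q).hom d hs _
  have h12 : (D.d : WithBot ℕ∞) = (d : WithBot ℕ∞) := h1.symm.trans h2
  exact_mod_cast h12

/-- **The pieces of a CURVE are curves**: for `X` smooth of relative dimension `1`, every piece of every pieces datum is a smooth projective
complex CURVE (`d_eq`). [cite: Liu2021, proof of Lemma 2.4 (1) (FJcycle.tex l. 1220–1222)] [cite: GortzWedhorn2020, Lemma 6.26] -/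
theorem isSmoothProjective_one_of_curve [SmoothOfRelativeDimension 1 X.hom] (q : D.Ξ) : IsSmoothProjective 1 (D.Y q) :=
  D.d_eq (d := 1) q ▸ D.smoothProjective q

/-- **[Liu2021, Lem. 2.4 (1)] for the chosen pieces of a smooth projective CURVE, `ℂ`-coefficients, hypothesis-free**:
`(α_X)_x^* : H¹((Alb_X ⊗ ℂ)(ℂ); ℂ) → H¹((X ⊗ ℂ)(ℂ); ℂ)` is bijective for `X / k` projective and smooth of relative dimension `1` — A-p16's ★
`complexBetti_map_albAt_bijective_of_finrank_le` with (R-ℂ) discharged on the curve pieces by ★ `two_mul_dim_eq_finrank_bettiCohomology_holds`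
(`2 dim J(C) = b₁(C)`). [cite: Liu2021, Lemma 2.4 (1) (FJcycle.tex l. 1210–1213) with proof (l. 1220–1228)] [cite: Milne1986JacobianVarieties, §7 Thm. 7.1] -/
theorem complexBetti_map_albAt_bijective_of_curve [SmoothOfRelativeDimension 1 X.hom] (hX : IsProjectiveOver X) :
    Bijective (complexBetti.map (D.albAt a) 1).hom :=
  D.complexBetti_map_albAt_bijective_of_finrank_le a (d := 1) hX fun q 𝒥 ↦
    (two_mul_dim_eq_finrank_bettiCohomology_holds (D.Y q) (D.isSmoothProjective_one_of_curve q) 𝒥).ge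

end AlbanesePieces

section Curve

variable {k : Type} [Field k] [Algebra k ℂ]

/-- **`albaneseH1Cmp X a = ((α_X)_x)^*` for EVERY pieces datum** (not only the chosen one): the comparison map is `(complexBetti.map (D.albAt a) 1).hom`
for any `D : AlbanesePieces X` (★ `albaneseH1Cmp_eq` + `complexBetti_map_albAt_hom_eq`) — kills the «chosen pieces vs known pieces» gap:
a consumer holding its OWN cofan of pieces (e.g. the record's `pieces`, GS-7a) reads `albaneseH1Cmp` on it.
[cite: Liu2021, proof of Lemma 2.4 (1) (FJcycle.tex l. 1220–1228)] -/
theorem albaneseH1Cmp_eq_complexBetti_map_albAt {X : SchemeOver k} (D : AlbanesePieces X) (a : Albanese X) :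
    albaneseH1Cmp X a = (complexBetti.map (D.albAt a) 1).hom := by
  rw [albaneseH1Cmp_eq X a ⟨D⟩]
  exact (Classical.choice (⟨D⟩ : Nonempty (AlbanesePieces X))).complexBetti_map_albAt_hom_eq a D 1

/-- **`albaneseH1Cmp` is bijective on a smooth projective `X` whose complex pieces are given as compact ball-quotient SURFACES** (a colimit
cofan `inj q : Y q ⟶ X ⊗_k ℂ` with `UnitaryBallUniformisationDatum 2 (Y q)` on every piece — the levels of the compact unitary Shimura
surface tower, pieces by [Deligne1979] 2.1.2): A-p16's ★ `complexBetti_map_albAt_bijective_of_ballDatum` on the pieces datum built from the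
cofan (base points from ★ `nonempty_algPoints_of_isSmoothProjective`), read through `albaneseH1Cmp_eq_complexBetti_map_albAt`.
[cite: Liu2021, Lemma 2.4 (1) (FJcycle.tex l. 1210–1213)] [cite: Arapura2012, Cor. 15.4.6] [cite: Deligne1979ShimuraVarieties, 2.1.2] -/
theorem bijective_albaneseH1Cmp_of_cofan_ballDatum {X : SchemeOver k} (a : Albanese X) {d : ℕ} [SmoothOfRelativeDimension d X.hom]
    (hX : IsProjectiveOver X) {Ξ : Type} [Finite Ξ] (Y : Ξ → SchemeOver ℂ) (inj : ∀ q, Y q ⟶ (bcFunctor k ℂ).obj X)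
    (hcol : IsColimit (Cofan.mk ((bcFunctor k ℂ).obj X) inj)) (B : ∀ q, UnitaryBallUniformisationDatum 2 (Y q)) :
    Bijective (albaneseH1Cmp X a) := by
  let D : AlbanesePieces X := ⟨Ξ, ‹_›, 2, Y, fun q ↦ (B q).isSmoothProjective, inj, hcol,
    fun q ↦ (nonempty_algPoints_of_isSmoothProjective (B q).isSmoothProjective).some⟩
  rw [albaneseH1Cmp_eq_complexBetti_map_albAt D a]
  exact D.complexBetti_map_albAt_bijective_of_ballDatum a (d := d) hX B

/-- **… hence injective** — the target-level `cmpT` injectivity «`y ≠ 0 ⇒ albaneseH1Cmp X_K A_K y ≠ 0`» at the face's levels, fed by a cofan of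
ball-quotient pieces (e.g. ★ GS-7a's legs). [cite: Liu2021, Lemma 2.4 (1) (FJcycle.tex l. 1210–1213); Thm. 4.15 proof l. 2212] [cite: Arapura2012, Cor. 15.4.6] -/
theorem injective_albaneseH1Cmp_of_cofan_ballDatum {X : SchemeOver k} (a : Albanese X) {d : ℕ} [SmoothOfRelativeDimension d X.hom]
    (hX : IsProjectiveOver X) {Ξ : Type} [Finite Ξ] (Y : Ξ → SchemeOver ℂ) (inj : ∀ q, Y q ⟶ (bcFunctor k ℂ).obj X)
    (hcol : IsColimit (Cofan.mk ((bcFunctor k ℂ).obj X) inj)) (B : ∀ q, UnitaryBallUniformisationDatum 2 (Y q)) :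
    Injective (albaneseH1Cmp X a) :=
  (bijective_albaneseH1Cmp_of_cofan_ballDatum a (d := d) hX Y inj hcol B).1

/-- **`albaneseH1Cmp` is injective on a smooth projective `X` whose complex pieces are given as smooth projective CURVES** (a colimit cofan with
`IsSmoothProjective 1 (Y q)` and a complex point on every piece): A-p16's ★ `injective_complexBetti_map_albAt_of_isSmoothProjective_one` read
through `albaneseH1Cmp_eq_complexBetti_map_albAt`.  (For `X` itself a curve no cofan is needed: `albaneseH1Cmp_bijective_of_curve`.)
[cite: Liu2021, Lemma 2.4 (1) (FJcycle.tex l. 1210–1213)] [cite: Milne1986JacobianVarieties, §7 Thm. 7.1] -/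
theorem injective_albaneseH1Cmp_of_cofan_curve {X : SchemeOver k} (a : Albanese X) {d : ℕ} [SmoothOfRelativeDimension d X.hom]
    (hX : IsProjectiveOver X) {Ξ : Type} [Finite Ξ] (Y : Ξ → SchemeOver ℂ) (inj : ∀ q, Y q ⟶ (bcFunctor k ℂ).obj X)
    (hcol : IsColimit (Cofan.mk ((bcFunctor k ℂ).obj X) inj)) (hY : ∀ q, IsSmoothProjective 1 (Y q)) (pt : ∀ q, AlgPoints (Y q) ℂ) :
    Injective (albaneseH1Cmp X a) := by
  let D : AlbanesePieces X := ⟨Ξ, ‹_›, 1, Y, hY, inj, hcol, pt⟩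
  rw [albaneseH1Cmp_eq_complexBetti_map_albAt D a]
  exact D.injective_complexBetti_map_albAt_of_isSmoothProjective_one a (d := d) hX hY

/-- **[Liu2021, Lem. 2.4 (1)], HYPOTHESIS-FREE FOR SMOOTH PROJECTIVE CURVES**: for `X / k` projective and smooth of relative dimension `1`
over a field `k → ℂ` and any Albanese datum `a = (∇X, Alb_X, α_X)` of `X` (Def. 2.3), the comparison map
`albaneseH1Cmp X a = ((α_X)_x)^* : H¹_{B}(Alb_X ⊗_k ℂ, ℂ) → H¹_{B}(X ⊗_k ℂ, ℂ)` is a BIJECTION — the projective edition of Lemma 2.4 (1)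
(★ `albanese_bettiOne_pullback_bijective_of_isProjectiveOver`, through A-p16's ★ `complexBetti_map_albAt_bijective_of_finrank_le`) at the
chosen pieces (★ `albaneseH1Cmp_eq`), the complex Albanese bound being a theorem for curves (`2 dim J(C) = b₁(C)`).  No named fact is used. [cite: Liu2021, Lemma 2.4 (1) (FJcycle.tex l. 1210–1213) with proof (l. 1220–1228); Def. 2.3 (l. 1202–1208)]
[cite: Milne1986JacobianVarieties, §2 Prop. 2.1 and §7 Thm. 7.1] -/
theorem albaneseH1Cmp_bijective_of_curve (X : SchemeOver k) [SmoothOfRelativeDimension 1 X.hom] (hX : IsProjectiveOver X)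
    (a : Albanese X) : Bijective (albaneseH1Cmp X a) := by
  rw [albaneseH1Cmp_eq X a (nonempty_albanesePieces (d := 1) X hX)]
  exact (Classical.choice (nonempty_albanesePieces (d := 1) X hX)).complexBetti_map_albAt_bijective_of_curve a hX

/-- The same for a relative dimension GIVEN AS `d` with `d = 1` (the shape `CompactifiedSystem.smooth_X` hands: `P5.n - 1`).
[cite: Liu2021, Lemma 2.4 (1) (FJcycle.tex l. 1210–1213); App. C l. 4656 (`X_K` smooth projective)] -/
theorem albaneseH1Cmp_bijective_of_relativeDimension_eq_one (X : SchemeOver k) {d : ℕ} (hs : SmoothOfRelativeDimension d X.hom)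
    (hd : d = 1) (hX : IsProjectiveOver X) (a : Albanese X) : Bijective (albaneseH1Cmp X a) := by
  subst hd
  exact albaneseH1Cmp_bijective_of_curve X hX a

end Curve

end PiecesAndCurves

/-! ## §2 The GS-7 spine with `cmpT`/`cmpS := albaneseH1Cmp`, `hnat`, `hinjS` discharged -/

section Spine

-- (`⊗[R]` is not used as notation here: a scoped notation of this namespace shadows it; `TensorProduct R M N` is spelled out.)
open Literature.AlgebraicGeometry.Motives (AbelianVariety)
open Literature.AlgebraicGeometry.Motives.AbelianVariety (rationalTateModuleMap)

variable {F E : Type} [Field F] [NumberField F] [IsTotallyReal F] [Field E] [NumberField E] [Algebra F E]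
  [IsTotallyComplex E] [Algebra.IsQuadraticExtension F E]
variable {P5ₛ P5 : PropC5Data F E} {isoₛ iso : ℕ → Prop}
variable {Cₛ : Sec42Data P5ₛ isoₛ} {C : Sec42Data P5 iso} {Tₛ : Cₛ.HeckeTranslates} {T : C.HeckeTranslates}
  {φ : Cₛ.G →* C.G} {hφ : Continuous φ}

/-- **`hnat` FED**: Lemma 2.4 (1) is natural in `Sh(φ)_K` for the Summits-side comparisons `albaneseH1Cmp`:
`albaneseH1Cmp X⋆ a⋆ (Alb(Sh(φ)_K)^* y) = (Sh(φ)_K ×_{τ'} ℂ)^* (albaneseH1Cmp X_K a_K y)` — ★ `albaneseH1Cmp_natural` at the α-compatible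
pair `(Sh(φ)_K, ∇(Sh(φ)_K), Alb(Sh(φ)_K))` (★ `Nabla.map_incl`, ★ `TowerHom.α_albMap`; both levels smooth projective by ★
`CompactifiedSystem.smooth_X` ∕ `projective_X`), verbatim the feeding of ★ `TowerHom.albCmp_bettiPullAlong_albMap` but with NO comparison
family `cA` and NO named fact. [cite: Liu2021, Lem. 2.4 (1) (FJcycle.tex l. 1210–1213) with Def. 2.3 (l. 1206–1208); §4.2 l. 2064–2074] -/
theorem towerHom_albaneseH1Cmp_bettiPullAlong_albMap (M : Sec42Data.TowerHom Cₛ C Tₛ T φ hφ) {τ' : E →+* ℂ}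
    (K : C5.SmallLevel C.S.K₀) (y : C.bettiH1 τ' K) :
    letI : Algebra E ℂ := algebraAlong E τ'
    albaneseH1Cmp (Cₛ.X (M.src K)) (Cₛ.alb (M.src K)) (bettiPullAlong τ' (M.albMap K) y) =
      schemeBettiPullAlong τ' (M.map K) (albaneseH1Cmp (C.X K) (C.alb K) y) := by
  letI : Algebra E ℂ := algebraAlong E τ'
  exact albaneseH1Cmp_natural (Cₛ.alb (M.src K)) (C.alb K) _ _ (Cₛ.cpt.smooth_X (M.src K)) (Cₛ.cpt.projective_X (M.src K))
    (C.cpt.smooth_X K) (C.cpt.projective_X K) (M.map K) _ (M.albMap K)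
    ((Cₛ.alb (M.src K)).nabla.map_incl (C.alb K).nabla (M.map K)) (M.α_albMap K) y

/-- **`hinjS` FED for every tower of CURVES**: for a §4.2 datum `Cₛ` over a Prop-C.5 datum with `n = 2` (so that every `X⋆_K` is a
projective curve smooth of relative dimension `n - 1 = 1`, ★ `CompactifiedSystem.smooth_X` ∕ `projective_X` — e.g. the GS seesaw source,
[Liu2021] Thm. 4.15 proof's `Sh(G⋆, h⋆)`), `albaneseH1Cmp X⋆_K A⋆_K` is injective (indeed bijective: `albaneseH1Cmp_bijective_of_curve`).
[cite: Liu2021, Lemma 2.4 (1) (FJcycle.tex l. 1210–1213); App. C l. 4656; Thm. 4.15 proof l. 2199–2213] -/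
theorem sec42Data_injective_albaneseH1Cmp_of_n_eq_two (Cₛ : Sec42Data P5ₛ isoₛ) (hn : P5ₛ.n = 2) {τ' : E →+* ℂ}
    (K : C5.SmallLevel Cₛ.S.K₀) :
    letI : Algebra E ℂ := algebraAlong E τ'
    Injective (albaneseH1Cmp (Cₛ.X K) (Cₛ.alb K)) := by
  letI : Algebra E ℂ := algebraAlong E τ'
  have hd : P5ₛ.n - 1 = 1 := by omega
  exact (albaneseH1Cmp_bijective_of_relativeDimension_eq_one (Cₛ.X K) (Cₛ.cpt.smooth_X K) hd
    (Cₛ.cpt.projective_X K) (Cₛ.alb K)).1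

variable {ℓ : ℕ} [Fact ℓ.Prime] {X : C.EtaleHeckeDatum ℓ}
variable {τ' : E →+* ℂ} {H : Type} [AddCommGroup H] [Module ℂ H] {rhoB : Representation ℂ C.G H}
  (B : C.BettiPinning T τ' H rhoB) (ι : ℂ ≃+* AlgebraicClosure ℚ_[ℓ]) (c : H1ComparisonFamily (E := E) τ' ℓ ι)
variable {W : Type} [AddCommGroup W] [Module ℂ W] {ρW : Representation ℂ C.G W}
  {f : W →ₛₗ[(ι : ℂ →+* AlgebraicClosure ℚ_[ℓ])] TensorProduct ℚ_[ℓ] (AlgebraicClosure ℚ_[ℓ]) (C.etaleH1Tower ℓ)}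

/-- **CLAUSE (1) FROM ONE DETECTION AT THE CONJUGATE LEVEL, comparisons `albaneseH1Cmp`** (★ §6
`TowerHom.baseChange_etPull_toEtaleTowerHom_comp_ne_zero_of_scheme_hecke` with `cmpT, cmpS := albaneseH1Cmp` and `hnat` DISCHARGED by
`towerHom_albaneseH1Cmp_bettiPullAlong_albMap`): if `f w = cmp (b_{K′} y)`, `g⁻¹Λg ⊆ K′`, `M` has `hIₛ`, `albaneseH1Cmp` is injective at the
source level `X⋆_{φ⁻¹Λ ∩ K₀⋆}` (`sec42Data_injective_albaneseH1Cmp_of_n_eq_two` for a curve source) and `Sh(φ)_Λ` DETECTS the translated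
class `albaneseH1Cmp X_Λ A_Λ (Alb(T_g)^* y)`, then `((1 ⊗ M.toEtaleTowerHom.etPull)).comp f ≠ 0`.
[cite: Liu2021, Thm. 4.15 proof (FJcycle.tex l. 2199–2213); §4.3 l. 2160–2165] [cite: SGA4Tome3, Exp. XI Thm. 4.4] -/
theorem towerHom_baseChange_etPull_comp_ne_zero_of_albaneseH1Cmp_hecke (M : Sec42Data.TowerHom Cₛ C Tₛ T φ hφ)
    (hIₛ : ∀ ⦃K K' : C5.SmallLevel Cₛ.S.K₀⦄ (u : K' ⟶ K), Injective (rationalTateModuleMap ℓ (Cₛ.Atr u)).dualMap)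
    (hX : X.IsInducedBy T) (hf : f ∈ X.omegaHom ι ρW)
    {w : W} {Λ K' : C5.SmallLevel C.S.K₀} {y : C.bettiH1 τ' K'} (hwy : f w = B.cmpAlong ℓ ι c (B.b K' y))
    (g : C.G) (h : C5.HeckeLE g Λ K')
    (hinjS : letI : Algebra E ℂ := algebraAlong E τ'; Injective (albaneseH1Cmp (Cₛ.X (M.src Λ)) (Cₛ.alb (M.src Λ))))
    (hdet : letI : Algebra E ℂ := algebraAlong E τ'
      schemeBettiPullAlong τ' (M.map Λ) (albaneseH1Cmp (C.X Λ) (C.alb Λ) (bettiPullAlong τ' (T.albTr g Λ K' h) y)) ≠ 0) :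
    ((M.toEtaleTowerHom.etPull ℓ).baseChange (AlgebraicClosure ℚ_[ℓ])).comp f ≠ 0 :=
  letI : Algebra E ℂ := algebraAlong E τ'
  M.baseChange_etPull_toEtaleTowerHom_comp_ne_zero_of_scheme_hecke B ι c hIₛ hX hf hwy g h
    (albaneseH1Cmp (C.X Λ) (C.alb Λ)) (albaneseH1Cmp (Cₛ.X (M.src Λ)) (Cₛ.alb (M.src Λ)))
    (fun y' ↦ towerHom_albaneseH1Cmp_bettiPullAlong_albMap M Λ y') hinjS hdet

/-- **THE GS-7 SPINE WITH HECKE RE-ENTRY AND ITS ALBANESE COMPARISONS DISCHARGED** (the head the (7-main)/GS-8 closer `exact`s; ★ §6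
`Sec42Data.BettiPinning.exists_scheme_class_detecting_hecke'` with `cmpT := albaneseH1Cmp (C.X Λ) (C.alb Λ)`,
`cmpS := albaneseH1Cmp (Cₛ.X (M.src Λ)) (Cₛ.alb (M.src Λ))` and `hnat` FED by `towerHom_albaneseH1Cmp_bettiPullAlong_albMap`): a non-zero
`f ∈ Hom_{ℚ_ℓ^{ac}[𝔾]}(ι∘ω, ℚ_ℓ^{ac} ⊗ H¹_ét(A_∞))` has `(w, K, y ≠ 0)` with `f w = cmp (b_K y)` such that for EVERY finer `K″ ⊆ K`
(`y″ := Alb(T_1)^* y ≠ 0`, `f w = cmp (b_{K″} y″)`) and EVERY `g`, `Λ` with `g⁻¹Λg ⊆ K″`: `f (ρ_ω(g) w) = cmp (b_Λ (Alb(T_g)^* y″))`, and EVERY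
morphism of towers `M` with `hIₛ` whose source-level `albaneseH1Cmp` is injective (curve sources: `sec42Data_injective_albaneseH1Cmp_of_n_eq_two`)
and whose `Sh(φ)_Λ` detects the VARIETY class `albaneseH1Cmp X_Λ A_Λ (Alb(T_g)^* y″)` satisfies `((1 ⊗ M.toEtaleTowerHom.etPull)).comp f ≠ 0`.
No comparison binders (`cmpT`, `cmpS`, `hnat`) are left. [cite: Liu2021, Thm. 4.15 proof (FJcycle.tex l. 2199–2213) with fn. 9; §4.2 l. 2070–2079; §4.3 l. 2152–2165; Lem. 2.4 (1) l. 1210–1213]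
[cite: MurtyRamakrishnan1992, Prop. 6 (through Liu2021 fn. 9)] [cite: Milne2005ShimuraVarieties, Thm. 13.6 p. 118] [cite: SGA4Tome3, Exp. XI Thm. 4.4] -/
theorem bettiPinning_exists_scheme_class_detecting_hecke_albaneseH1Cmp (hX : X.IsInducedBy T) (hf : f ∈ X.omegaHom ι ρW)
    (hf0 : f ≠ 0) :
    letI : Algebra E ℂ := algebraAlong E τ'
    ∃ (w : W) (K : C5.SmallLevel C.S.K₀) (y : C.bettiH1 τ' K), y ≠ 0 ∧ f w = B.cmpAlong ℓ ι c (B.b K y) ∧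
      ∀ (K'' : C5.SmallLevel C.S.K₀) (hle : C5.HeckeLE (1 : C.G) K'' K),
        bettiPullAlong τ' (T.albTr 1 K'' K hle) y ≠ 0 ∧
        f w = B.cmpAlong ℓ ι c (B.b K'' (bettiPullAlong τ' (T.albTr 1 K'' K hle) y)) ∧
        ∀ (g : C.G) (Λ : C5.SmallLevel C.S.K₀) (h : C5.HeckeLE g Λ K''),
          f (ρW g w) = B.cmpAlong ℓ ι c (B.b Λ
            (bettiPullAlong τ' (T.albTr g Λ K'' h) (bettiPullAlong τ' (T.albTr 1 K'' K hle) y))) ∧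
          ∀ {P5ₛ : PropC5Data F E} {isoₛ : ℕ → Prop} {Cₛ : Sec42Data P5ₛ isoₛ} {Tₛ : Cₛ.HeckeTranslates}
            {φ : Cₛ.G →* C.G} {hφ : Continuous φ} (M : Sec42Data.TowerHom Cₛ C Tₛ T φ hφ),
            (∀ ⦃L L' : C5.SmallLevel Cₛ.S.K₀⦄ (u : L' ⟶ L), Injective (rationalTateModuleMap ℓ (Cₛ.Atr u)).dualMap) →
            Injective (albaneseH1Cmp (Cₛ.X (M.src Λ)) (Cₛ.alb (M.src Λ))) →
              schemeBettiPullAlong τ' (M.map Λ) (albaneseH1Cmp (C.X Λ) (C.alb Λ)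
                  (bettiPullAlong τ' (T.albTr g Λ K'' h) (bettiPullAlong τ' (T.albTr 1 K'' K hle) y))) ≠ 0 →
                ((M.toEtaleTowerHom.etPull ℓ).baseChange (AlgebraicClosure ℚ_[ℓ])).comp f ≠ 0 := by
  letI : Algebra E ℂ := algebraAlong E τ'
  obtain ⟨w, K, y, hy, hfw, hall⟩ := B.exists_scheme_class_detecting_hecke' ι c hX hf hf0
  refine ⟨w, K, y, hy, hfw, fun K'' hle ↦ ?_⟩
  obtain ⟨hy'', hfw'', hgen⟩ := hall K'' hle
  refine ⟨hy'', hfw'', fun g Λ h ↦ ⟨(hgen g Λ h).1, ?_⟩⟩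
  intro P5' iso' C' T' φ' hφ' M hIₛ hinjS hdet
  exact (hgen g Λ h).2 M hIₛ (albaneseH1Cmp (C.X Λ) (C.alb Λ)) (albaneseH1Cmp (C'.X (M.src Λ)) (C'.alb (M.src Λ)))
    (fun y' ↦ towerHom_albaneseH1Cmp_bettiPullAlong_albMap M Λ y') hinjS hdet

/-- **The same for a source tower of CURVES** (`P5ₛ.n = 2`, e.g. the GS seesaw source `Sh(G⋆, h⋆)` of [Liu2021] Thm. 4.15's proof): the
source-level injectivity is `sec42Data_injective_albaneseH1Cmp_of_n_eq_two`, so the ∀-clause reads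
`∀ M, hIₛ → P5ₛ.n = 2 → (Sh(φ)_Λ ×_{τ'} ℂ)^* (albaneseH1Cmp X_Λ A_Λ (Alb(T_g)^* y″)) ≠ 0 → ((1 ⊗ M.toEtaleTowerHom.etPull)).comp f ≠ 0`.
[cite: Liu2021, Thm. 4.15 proof (FJcycle.tex l. 2199–2213) with fn. 9; Lem. 2.4 (1) l. 1210–1213] [cite: MurtyRamakrishnan1992, Prop. 6 (through Liu2021 fn. 9)] -/
theorem bettiPinning_exists_scheme_class_detecting_hecke_albaneseH1Cmp_of_n_eq_two (hX : X.IsInducedBy T)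
    (hf : f ∈ X.omegaHom ι ρW) (hf0 : f ≠ 0) :
    letI : Algebra E ℂ := algebraAlong E τ'
    ∃ (w : W) (K : C5.SmallLevel C.S.K₀) (y : C.bettiH1 τ' K), y ≠ 0 ∧ f w = B.cmpAlong ℓ ι c (B.b K y) ∧
      ∀ (K'' : C5.SmallLevel C.S.K₀) (hle : C5.HeckeLE (1 : C.G) K'' K),
        bettiPullAlong τ' (T.albTr 1 K'' K hle) y ≠ 0 ∧
        f w = B.cmpAlong ℓ ι c (B.b K'' (bettiPullAlong τ' (T.albTr 1 K'' K hle) y)) ∧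
        ∀ (g : C.G) (Λ : C5.SmallLevel C.S.K₀) (h : C5.HeckeLE g Λ K''),
          f (ρW g w) = B.cmpAlong ℓ ι c (B.b Λ
            (bettiPullAlong τ' (T.albTr g Λ K'' h) (bettiPullAlong τ' (T.albTr 1 K'' K hle) y))) ∧
          ∀ {P5ₛ : PropC5Data F E} {isoₛ : ℕ → Prop} {Cₛ : Sec42Data P5ₛ isoₛ} {Tₛ : Cₛ.HeckeTranslates}
            {φ : Cₛ.G →* C.G} {hφ : Continuous φ} (M : Sec42Data.TowerHom Cₛ C Tₛ T φ hφ),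
            (∀ ⦃L L' : C5.SmallLevel Cₛ.S.K₀⦄ (u : L' ⟶ L), Injective (rationalTateModuleMap ℓ (Cₛ.Atr u)).dualMap) →
            P5ₛ.n = 2 →
              schemeBettiPullAlong τ' (M.map Λ) (albaneseH1Cmp (C.X Λ) (C.alb Λ)
                  (bettiPullAlong τ' (T.albTr g Λ K'' h) (bettiPullAlong τ' (T.albTr 1 K'' K hle) y))) ≠ 0 →
                ((M.toEtaleTowerHom.etPull ℓ).baseChange (AlgebraicClosure ℚ_[ℓ])).comp f ≠ 0 := by
  letI : Algebra E ℂ := algebraAlong E τ'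
  obtain ⟨w, K, y, hy, hfw, hall⟩ := bettiPinning_exists_scheme_class_detecting_hecke_albaneseH1Cmp B ι c hX hf hf0
  refine ⟨w, K, y, hy, hfw, fun K'' hle ↦ ?_⟩
  obtain ⟨hy'', hfw'', hgen⟩ := hall K'' hle
  refine ⟨hy'', hfw'', fun g Λ h ↦ ⟨(hgen g Λ h).1, ?_⟩⟩
  intro P5' iso' C' T' φ' hφ' M hIₛ hn hdet
  exact (hgen g Λ h).2 M hIₛ (sec42Data_injective_albaneseH1Cmp_of_n_eq_two C' hn (M.src Λ)) hdet

end Spine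

end Summit.HodgeConjecture.CorCM.D2Bridge

end
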